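import Summits.CriticalPhenomena.PercolationContinuityZ3.Theorems.Transplant.CayleyCylinderStrict
import HarnessLib

/-!
# The abstract Cayley-graph theorem WITHOUT a finite-conjugacy element: `CayleyNeg₀`, `CayleySign₀`

builds on p205010 (kernel theorem, internal audit signed; external expert review pending).
Lane `prim-bschramm`, seat `prim-bschramm-p4` gen 10 (PART C3 of `P4-GENERAL.md`: TIER 2′ closed at the Cayley level).  Helper file
(`--supports stmt-CriticalPhenomena-4575 --as helper`).

`CayleySign` (p307794, gen 9) asked for: an additive `φ : Γ → ℤ²` of sup-norm `≤ 1` on `S` with unit steps, `S`-preserving automorphisms `ν`, `κ`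
acting on `φ` by `−I` and `diag(1, −1)`, connected cylinders, AND an element of finite conjugacy class outside `ker φ` (used only to make the
cylinders strictly subcritical at `p_c`, Martineau–Severo through a centralised translation).  The last datum is void exactly for the free
nilpotent groups `N_{m,2}`, `m ≥ 3`, `N_{2,3}`, … (centre `⊆ [Γ,Γ] ⊆ ker φ`), tier 2′ of the class map.  `CayleyCylinderStrict` proves Φ2 at
`p_c` for EVERY such skeleton whose kernel is generated by the generators it contains (an Aizenman–Grimmett / Menshikov essential-enhancement
strict inequality `p_c(C_{ℓ+1}) < p_c(C_ℓ)`, kernel).  Hence: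

* `CayleyNeg₀` / `CayleySign₀` — the data without `z, z_φ, reps, cofinite`, with the kernel criterion `⟨S ∩ ker φ⟩ = ker φ` as the
  connectivity datum; `CayleyNeg₀.skeleton : PlanarSkeletonNeg`, `CayleySign₀.skeletonSign : PlanarSkeletonSign`;
* `CayleyNeg₀.cylSubcritical_of_le` — Φ2 at every `p ≤ p_c` (no FC element);
* **`CayleySign₀.criticalContinuity` — `θ_g(p_c) = 0` at every vertex of `Cay(Γ; S)`, UNCONDITIONALLY** (closed D″ node + Φ2);
* `CayleyNeg₀.criticalContinuity_of_negNode₁` — the `{±1}` version modulo the N1 node;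
* `CayleyNeg.toNeg₀OfKer` — every `CayleyNeg` with the kernel criterion is a `CayleyNeg₀` (the old customers keep working).
[cite: BenjaminiSchramm1996, Conj. 4; §2] [cite: AizenmanGrimmett1991, Thm 1] [cite: KozmaNitzan2024, §1 p. 2 (approach 1)]
-/

noncomputable section

namespace Summit.CriticalPhenomena.PercolationContinuityZ3.Theorems.Transplant

open SimpleGraph Literature.Probability.LatticeModels Literature.Probability.Percolation
open Literature.Barriers.CriticalPhenomena (countable_of_connected_of_locallyFinite)
open scoped Classical


/-! ## §1 `CayleyNeg₀` -/

/-- **INPUT of P4-GENERAL tier 2′ for a Cayley graph, `{±1}` version, WITHOUT a finite-conjugacy element**: an additive `φ : Γ → ℤ²` of sup-norm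
`≤ 1` on the generators with unit steps realised in `S`, a group automorphism `ν` preserving `S` with `φ ∘ ν = −φ`, and the kernel of `φ`
generated by the generators it contains. [cite: KozmaNitzan2024, §4 p. 16 (Lemma 8)] [cite: BenjaminiSchramm1996, §2; Conj. 4] -/
structure CayleyNeg₀ (Γ : Type) [Group Γ] (S : Finset Γ) where
  /-- the skeleton homomorphism `φ : Γ → ℤ²` -/
  φ : Γ → Site 2
  /-- additivity -/
  map_mul : ∀ g h : Γ, φ (g * h) = φ g + φ h
  /-- generators have sup-norm `≤ 1` -/
  lip : ∀ s ∈ S, ∀ i : Fin 2, |φ s i| ≤ 1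
  /-- unit steps: some generator maps to each basis vector -/
  step : ∀ i : Fin 2, ∃ s ∈ S, φ s = Pi.single i 1
  /-- the reversing automorphism -/
  ν : Γ ≃* Γ
  /-- `ν` preserves the generating system -/
  ν_mem : ∀ s, ν s ∈ S ↔ s ∈ S
  /-- `φ ∘ ν = −φ` -/
  ν_φ : ∀ g, φ (ν g) = -φ g
  /-- the kernel criterion: `ker φ` is generated by the generators of height `0` -/
  ker_gen : ∀ g : Γ, φ g = 0 → g ∈ Subgroup.closure (↑(S.filter fun s => φ s = 0) : Set Γ)

namespace CayleyNeg₀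

variable {Γ : Type} [Group Γ] {S : Finset Γ} (D : CayleyNeg₀ Γ S)

/-- The cylinder data of a `CayleyNeg₀`. [folklore] -/
def cylData : CayCyl.CylData Γ S where
  φ := D.φ
  map_mul := D.map_mul
  lip := D.lip
  s₀ := Classical.choose (D.step 0)
  s₀_mem := (Classical.choose_spec (D.step 0)).1
  φ_s₀ := (Classical.choose_spec (D.step 0)).2
  s₁ := Classical.choose (D.step 1)
  s₁_mem := (Classical.choose_spec (D.step 1)).1
  φ_s₁ := (Classical.choose_spec (D.step 1)).2
  ker_gen := D.ker_gen

/-- `φ 1 = 0`. [folklore] -/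
theorem φ_one : D.φ 1 = 0 := D.cylData.φ_one

/-- **THE SKELETON OF A `CayleyNeg₀`**: one type (the identity), left multiplications as frames, `ν` as the central inversion, degree
bound `2|S|`, unit steps, connected cylinders by the kernel criterion. [cite: KozmaNitzan2024, §4 p. 16 (Lemma 8)] [cite: BenjaminiSchramm1996, §2] -/
def skeleton : PlanarSkeletonNeg (mulCayley (S : Set Γ)) where
  φ := D.φ
  lip := fun _ _ h i => by rw [abs_sub_comm]; exact D.cylData.lip_adj h i
  types := {1}
  frame := fun v => ⟨1, Finset.mem_singleton_self 1, leftMulIso S v, mul_one v, fun w => by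
    show D.φ (v * w) = D.φ w + (D.φ v - D.φ 1)
    rw [D.map_mul, φ_one, sub_zero, add_comm]⟩
  neg := fun t ht => by
    rw [Finset.mem_singleton] at ht
    subst ht
    refine ⟨autOfMulEquiv S D.ν D.ν_mem, map_one D.ν, fun w => ?_⟩
    show D.φ (D.ν w) - D.φ 1 = -(D.φ w - D.φ 1)
    rw [φ_one, sub_zero, sub_zero, D.ν_φ]
  Δ := 2 * S.card
  degree_le := degree_mulCayley_le S
  step := fun v i σ => by
    obtain ⟨s, hs, hφ⟩ := D.step i
    have hs1 : s ≠ 1 := by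
      intro h
      have h0 := congrFun hφ i
      rw [h, φ_one] at h0
      simp at h0
    rcases Int.units_eq_one_or σ with rfl | rfl
    · exact ⟨v * s, CayCyl.adj_mul_of_mem S (Or.inl hs) hs1 v, by rw [D.map_mul, hφ, Units.val_one]⟩
    · refine ⟨v * s⁻¹, CayCyl.adj_mul_of_mem S (Or.inr (by rw [inv_inv]; exact hs)) (inv_ne_one.2 hs1) v, ?_⟩
      rw [D.map_mul, show D.φ s⁻¹ = -D.φ s from D.cylData.φ_inv s, hφ, Units.val_neg, Units.val_one, Pi.single_neg]
  cyl_connected := fun t ht ℓ _ => by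
    rw [Finset.mem_singleton] at ht
    subst ht
    have e : {w | D.φ w - D.φ 1 ∈ box 2 ℓ} = {g | D.φ g ∈ box 2 ℓ} := by ext w; simp [φ_one]
    rw [e]
    exact CayleyKernel.cyl_connected_of_ker_generated D.φ D.map_mul D.step D.ker_gen ℓ

/-- **Φ2 AT AND BELOW `p_c` FOR EVERY `CayleyNeg₀`** — no finite-conjugacy element: for every `p ≤ p_c(Cay(Γ;S))` every cylinder of the
skeleton is subcritical at `p`, because `p_c(Cay) ≤ p_c(C_{ℓ+1}) < p_c(C_ℓ)` by the essential-enhancement strict inequality of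
`CayleyCylinderStrict`. [cite: AizenmanGrimmett1991, Thm 1 (essential enhancements)] [cite: Menshikov1987, Thm (graph and subgraph)] -/
theorem cylSubcritical_of_le {p : unitInterval} (hp : p ≤ criticalProbIOf (mulCayley (S : Set Γ)) (1 : Γ)) : D.skeleton.CylSubcritical p := by
  intro t ht ℓ
  change t ∈ ({1} : Finset Γ) at ht
  rw [Finset.mem_singleton] at ht
  subst ht
  haveI : Countable Γ := countable_of_connected_of_locallyFinite _ (D.skeleton.graph_connected (1 : Γ)) 1
  have e : {w | D.skeleton.φ w - D.skeleton.φ 1 ∈ box 2 ℓ} = D.cylData.V ℓ := by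
    ext w; simp [CayCyl.CylData.V, cylData, skeleton, φ_one]
  show theta ((mulCayley (S : Set Γ)).induce {w | D.skeleton.φ w - D.skeleton.φ 1 ∈ box 2 ℓ}) ⟨1, _⟩ _ = 0
  rw [theta_induce_congr _ e]
  have hG : criticalProb (mulCayley (S : Set Γ)) (1 : Γ) < 1 := D.skeleton.criticalProb_lt_one 1
  have hmono : criticalProb (mulCayley (S : Set Γ)) (1 : Γ) ≤ criticalProb (D.cylData.cylG (ℓ + 1)) ⟨1, D.cylData.one_mem_V (ℓ + 1)⟩ :=
    criticalProb_le_induce theta_induce_le_holds _ _ _ _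
  have hlt : criticalProb (mulCayley (S : Set Γ)) (1 : Γ) < criticalProb (D.cylData.cylG ℓ) ⟨1, D.cylData.one_mem_V ℓ⟩ := by
    rcases (criticalProb_mem_Icc (D.cylData.cylG ℓ) ⟨1, D.cylData.one_mem_V ℓ⟩).2.lt_or_eq with h | h
    · exact hmono.trans_lt (D.cylData.criticalProb_cyl_lt ℓ h)
    · rw [h]; exact hG
  exact theta_eq_zero_of_lt_criticalProb_holds _ _ _ (lt_of_le_of_lt hp hlt)

include D in
/-- **CONDITIONAL THEOREM: `θ_g(p_c) = 0` on `Cay(Γ; S)` for every `CayleyNeg₀`, modulo `SamePDropOfSkeletonNeg₁`** (one type; Φ2 derived,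
no finite-conjugacy element). [cite: BenjaminiSchramm1996, Conj. 4; §2] -/
theorem criticalContinuity_of_negNode₁ (hD : SamePDropOfSkeletonNeg₁) (g : Γ) :
    theta (mulCayley (S : Set Γ)) g (criticalProbIOf (mulCayley (S : Set Γ)) g) = 0 := by
  haveI : Countable Γ := countable_of_connected_of_locallyFinite _ (D.skeleton.graph_connected g) g
  have hbase : theta (mulCayley (S : Set Γ)) (1 : Γ) (criticalProbIOf (mulCayley (S : Set Γ)) 1) = 0 :=
    continuity_of_negNode₁ hD _ D.skeleton (Finset.mem_singleton_self 1) rfl (D.cylSubcritical_of_le le_rfl)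
  have hθ := theta_iso (leftMulIso S g) (1 : Γ) (criticalProbIOf (mulCayley (S : Set Γ)) 1)
  have hpc := criticalProb_iso (leftMulIso S g) (1 : Γ)
  rw [leftMulIso_apply, mul_one] at hθ hpc
  have e : criticalProbIOf (mulCayley (S : Set Γ)) g = criticalProbIOf (mulCayley (S : Set Γ)) 1 := Subtype.ext hpc
  rw [e, hθ]
  exact hbase

end CayleyNeg₀

/-! ## §2 `CayleySign₀` and the unconditional theorem -/

/-- **INPUT of P4-GENERAL tier 2′, `(ℤ/2)²` version**: a `CayleyNeg₀` plus a second `S`-preserving automorphism `κ` with `φ ∘ κ = (φ₀, −φ₁)`.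
[cite: KozmaNitzan2024, §4 p. 16 (Lemma 8)] [cite: BenjaminiSchramm1996, §2; Conj. 4] -/
structure CayleySign₀ (Γ : Type) [Group Γ] (S : Finset Γ) extends CayleyNeg₀ Γ S where
  /-- the axis flip -/
  κ : Γ ≃* Γ
  /-- `κ` preserves the generating system -/
  κ_mem : ∀ s, κ s ∈ S ↔ s ∈ S
  /-- `φ ∘ κ = flipSnd ∘ φ` -/
  κ_φ : ∀ g, φ (κ g) = flipSnd (φ g)

namespace CayleySign₀

variable {Γ : Type} [Group Γ] {S : Finset Γ} (D : CayleySign₀ Γ S)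

/-- **THE SIGN SKELETON OF A `CayleySign₀`** (`κ` induces the axis flip at the identity). [cite: KozmaNitzan2024, §4 p. 16 (Lemma 8)] -/
def skeletonSign : PlanarSkeletonSign (mulCayley (S : Set Γ)) where
  toPlanarSkeletonNeg := D.toCayleyNeg₀.skeleton
  flip := fun t ht => by
    change t ∈ ({1} : Finset Γ) at ht
    rw [Finset.mem_singleton] at ht
    subst ht
    refine ⟨autOfMulEquiv S D.κ D.κ_mem, map_one D.κ, fun w => ?_⟩
    show D.φ (D.κ w) - D.φ 1 = flipSnd (D.φ w - D.φ 1)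
    rw [D.toCayleyNeg₀.φ_one, sub_zero, sub_zero, D.κ_φ]

include D in
/-- **THEOREM (unconditional): `θ_g(p_c) = 0` at every vertex of `Cay(Γ; S)` for every group `Γ` and generating system `S` carrying a
`CayleySign₀`** — additive planar skeleton of unit range with unit steps, `S`-preserving automorphisms acting by `−I` and `diag(1, −1)`, kernel
generated by the generators it contains; NO central or finite-conjugacy element, no growth hypothesis.  Φ2 by the essential-enhancement strict
inequality for cylinders; `p_c < 1`, uniqueness, quasi-transitivity derived; the D″ node is closed in the tree.
builds on p205010 (kernel theorem, internal audit signed; external expert review pending).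
[cite: BenjaminiSchramm1996, Conj. 4; §2] [cite: AizenmanGrimmett1991, Thm 1] [cite: KozmaNitzan2024, §1 p. 2 (approach 1)] -/
theorem criticalContinuity (g : Γ) : theta (mulCayley (S : Set Γ)) g (criticalProbIOf (mulCayley (S : Set Γ)) g) = 0 :=
  PlanarSkeletonSign.criticalContinuity' _ D.skeletonSign
    (fun t ht => by
      have ht' : t = 1 := by
        change t ∈ ({1} : Finset Γ) at ht
        exact Finset.mem_singleton.1 ht
      subst ht'
      exact D.toCayleyNeg₀.cylSubcritical_of_le le_rfl) g

end CayleySign₀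

/-! ## §3 From the old data -/

/-- A `CayleyNeg` whose kernel is generated by its kernel generators is a `CayleyNeg₀` (forget `z`). [folklore] -/
def CayleyNeg.toNeg₀OfKer {Γ : Type} [Group Γ] {S : Finset Γ} (D : CayleyNeg Γ S)
    (hker : ∀ g : Γ, D.φ g = 0 → g ∈ Subgroup.closure (↑(S.filter fun s => D.φ s = 0) : Set Γ)) : CayleyNeg₀ Γ S where
  φ := D.φ
  map_mul := D.map_mul
  lip := D.lip
  step := D.step
  ν := D.ν
  ν_mem := D.ν_mem
  ν_φ := D.ν_φ
  ker_gen := hker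

end Summit.CriticalPhenomena.PercolationContinuityZ3.Theorems.Transplant

end
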